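import Summits.MatrixMultiplication.MatrixMultiplication.Theorems.OutsiderSandwichNoRefund
import HarnessLib

/-!
# The `2 × 2` core lemma: an annihilated pair `p·q = 0` has `dim range p + dim range q ≤ 4`

Route `OutsiderSandwich` (decomposition cell `decomp-mm`, lens 4, gen 28, addendum), support for
the aside leaf `BlockOneIsMM` (stmt-MatrixMultiplication-27147).  Pure linear algebra of `2 × 2`
complex matrices; no tensors.  This is the per-block heart of the level-one law
`a(1,m) = ⌈3m/2⌉` (sequel file), fed by the partial-weight transport
(`OutsiderSandwichPartialWeights`).

**Theorem** (`finrank_range_add_le_four`).  Let `U` be a finite-dimensional `ℂ`-space and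
`p, q : U → M₂(ℂ)` linear with `p(u)·q(u) = 0` for every `u`.  Then
`dim range p + dim range q ≤ 4`.

Proof.  Polarise: `p(u)q(u') + p(u')q(u) = 0`.  (A) If some `p(u₀)` is invertible then `q ≡ 0`.
(B) Else all `p(u)` are singular; pick `V₀ = p(u₀) ≠ 0`, `e₀ ≠ 0` with `V₀e₀ = 0`.  (B1) If every
`p(u)` kills `e₀`: `range p ⊂ {V : Ve₀ = 0}` and every column of every `q(u)` is a multiple of
`e₀`, so `range q ⊂ {Y : rY = 0}` (`r` a non-zero row of `V₀`) — two `2`-spaces.  (B2) If some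
`a = p(u₁)e₀ ≠ 0`: the lines `t ↦ p(u + tu₁)`, `p(u + tu₀)` are singular, and the coefficient of `t`
in `det[columns on the basis e₀, e₁] = 0` shows every column of every `p(u)` is parallel to `a`, so
`range p ⊂ {V : gV = 0}` (`g = (−a₁, a₀)`), while `ker p ≤ ker q` gives `dim range q ≤ dim range p`.

## References
* P. Bürgisser, M. Clausen, M. A. Shokrollahi, *Algebraic Complexity Theory*, Springer (1997),
  §14.4 (conciseness, slices) and §17.1 (substitution arguments). [BurgisserClausenShokrollahi1997]
* D. Coppersmith, S. Winograd, *Matrix multiplication via arithmetic progressions*,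
  J. Symbolic Comput. 9 (1990) 251–280, §7. [CoppersmithWinograd1990]
-/

noncomputable section
open scoped BigOperators Matrix
set_option linter.dupNamespace false
set_option autoImplicit false

namespace Summit.MatrixMultiplication.MatrixMultiplication.Theorems.OutsiderSandwichCoreTwoByTwo

/-- `cr x y = x₀y₁ − x₁y₀`, the determinant of the matrix with columns `x, y`.
[cite: BurgisserClausenShokrollahi1997, §14.4] -/
def cr (x y : Fin 2 → ℂ) : ℂ := x 0 * y 1 - x 1 * y 0

/-- `cr` is alternating. [cite: BurgisserClausenShokrollahi1997, §14.4] -/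
theorem cr_swap (x y : Fin 2 → ℂ) : cr x y = -cr y x := by unfold cr; ring

/-- `cr` is additive on the right. [cite: BurgisserClausenShokrollahi1997, §14.4] -/
theorem cr_add_right (x y z : Fin 2 → ℂ) : cr x (y + z) = cr x y + cr x z := by
  simp only [cr, Pi.add_apply]; ring

/-- `cr` is homogeneous on the right. [cite: BurgisserClausenShokrollahi1997, §14.4] -/
theorem cr_smul_right (x y : Fin 2 → ℂ) (t : ℂ) : cr x (t • y) = t * cr x y := by
  simp only [cr, Pi.smul_apply, smul_eq_mul]; ring

/-- `cr (Mx) (My) = det M · cr x y`. [cite: BurgisserClausenShokrollahi1997, §14.4] -/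
theorem cr_mulVec (M : Matrix (Fin 2) (Fin 2) ℂ) (x y : Fin 2 → ℂ) :
    cr (M.mulVec x) (M.mulVec y) = M.det * cr x y := by
  simp only [cr, Matrix.mulVec, dotProduct, Fin.sum_univ_two, Matrix.det_fin_two]
  ring

/-- A non-zero vector of `ℂ²` has a non-zero coordinate.
[cite: BurgisserClausenShokrollahi1997, §14.4] -/
theorem coord_ne_zero {e : Fin 2 → ℂ} (he : e ≠ 0) : e 0 ≠ 0 ∨ e 1 ≠ 0 := by
  rcases eq_or_ne (e 0) 0 with h0 | h0
  · rcases eq_or_ne (e 1) 0 with h1 | h1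
    · exfalso; apply he; funext i; fin_cases i
      · simpa using h0
      · simpa using h1
    · exact Or.inr h1
  · exact Or.inl h0

/-- Parallel vectors: `cr e x = 0`, `e ≠ 0` ⟹ `x ∈ ℂe`.
[cite: BurgisserClausenShokrollahi1997, §14.4] -/
theorem exists_smul_of_cr_eq_zero {e x : Fin 2 → ℂ} (he : e ≠ 0) (h : cr e x = 0) :
    ∃ t : ℂ, x = t • e := by
  unfold cr at h
  rcases coord_ne_zero he with h0 | h1
  · refine ⟨x 0 / e 0, ?_⟩
    have e0 : x 0 = x 0 / e 0 * e 0 := by field_simp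
    have e1 : x 1 = x 0 / e 0 * e 1 := by
      field_simp
      linear_combination h
    funext i; fin_cases i
    · simpa using e0
    · simpa using e1
  · refine ⟨x 1 / e 1, ?_⟩
    have e0 : x 0 = x 1 / e 1 * e 0 := by
      field_simp
      linear_combination -h
    have e1 : x 1 = x 1 / e 1 * e 1 := by field_simp
    funext i; fin_cases i
    · simpa using e0
    · simpa using e1

/-- A `2 × 2` matrix killing two non-parallel vectors is zero.
[cite: BurgisserClausenShokrollahi1997, §14.4] -/
theorem eq_zero_of_mulVec_pair {M : Matrix (Fin 2) (Fin 2) ℂ} {e x : Fin 2 → ℂ}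
    (hMe : M.mulVec e = 0) (hMx : M.mulVec x = 0) (h : cr e x ≠ 0) : M = 0 := by
  ext i j
  have r1 := congrFun hMe i
  have r2 := congrFun hMx i
  simp only [Matrix.mulVec, dotProduct, Fin.sum_univ_two, Pi.zero_apply] at r1 r2
  have c0 : M i 0 * cr e x = 0 := by unfold cr; linear_combination (x 1) * r1 - (e 1) * r2
  have c1 : M i 1 * cr e x = 0 := by unfold cr; linear_combination (e 0) * r2 - (x 0) * r1
  have m0 := (mul_eq_zero.1 c0).resolve_right h
  have m1 := (mul_eq_zero.1 c1).resolve_right h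
  fin_cases j
  · simpa using m0
  · simpa using m1

/-- A non-zero `2 × 2` matrix has a one-dimensional kernel: if `M ≠ 0` kills `e ≠ 0` and `x`, then
`x ∈ ℂe`. [cite: BurgisserClausenShokrollahi1997, §14.4] -/
theorem exists_smul_of_mulVec_eq_zero {M : Matrix (Fin 2) (Fin 2) ℂ} (hM : M ≠ 0)
    {e x : Fin 2 → ℂ} (he : e ≠ 0) (hMe : M.mulVec e = 0) (hMx : M.mulVec x = 0) :
    ∃ t : ℂ, x = t • e := by
  by_cases h : cr e x = 0
  · exact exists_smul_of_cr_eq_zero he h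
  · exact absurd (eq_zero_of_mulVec_pair hMe hMx h) hM

/-- Cramer on `ℂ²`: coordinates in the basis `e₀, e₁` (`cr e₀ e₁ ≠ 0`).
[cite: BurgisserClausenShokrollahi1997, §14.4] -/
theorem cramer_two {e₀ e₁ : Fin 2 → ℂ} (h : cr e₀ e₁ ≠ 0) (x : Fin 2 → ℂ) :
    x = (cr x e₁ / cr e₀ e₁) • e₀ + (cr e₀ x / cr e₀ e₁) • e₁ := by
  have key : cr e₀ e₁ • x = cr x e₁ • e₀ + cr e₀ x • e₁ := by
    funext i; fin_cases i
    · simp only [cr, Pi.smul_apply, Pi.add_apply, smul_eq_mul, Fin.zero_eta, Fin.isValue]; ring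
    · simp only [cr, Pi.smul_apply, Pi.add_apply, smul_eq_mul, Fin.mk_one, Fin.isValue]; ring
  calc x = (cr e₀ e₁)⁻¹ • (cr e₀ e₁ • x) := by rw [smul_smul, inv_mul_cancel₀ h, one_smul]
    _ = (cr x e₁ / cr e₀ e₁) • e₀ + (cr e₀ x / cr e₀ e₁) • e₁ := by
      rw [key, smul_add, smul_smul, smul_smul, div_eq_inv_mul, div_eq_inv_mul]

/-- `V ↦ V e` as a linear map in `V`. [cite: BurgisserClausenShokrollahi1997, §14.4] -/
def mulVecRight (e : Fin 2 → ℂ) : Matrix (Fin 2) (Fin 2) ℂ →ₗ[ℂ] (Fin 2 → ℂ) where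
  toFun V := V.mulVec e
  map_add' V W := Matrix.add_mulVec V W e
  map_smul' c V := by
    funext i
    simp only [Matrix.mulVec, dotProduct, Matrix.smul_apply, smul_eq_mul, RingHom.id_apply,
      Pi.smul_apply, Finset.mul_sum, mul_assoc]

/-- `Y ↦ r Y` as a linear map in `Y`. [cite: BurgisserClausenShokrollahi1997, §14.4] -/
def vecMulLeft (r : Fin 2 → ℂ) : Matrix (Fin 2) (Fin 2) ℂ →ₗ[ℂ] (Fin 2 → ℂ) where
  toFun Y := Matrix.vecMul r Y
  map_add' Y Z := Matrix.vecMul_add Y Z r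
  map_smul' c Y := Matrix.vecMul_smul r c Y

/-- `mulVecRight e` at `V`. [cite: BurgisserClausenShokrollahi1997, §14.4] -/
@[simp] theorem mulVecRight_apply (e : Fin 2 → ℂ) (V : Matrix (Fin 2) (Fin 2) ℂ) :
    mulVecRight e V = V.mulVec e := rfl

/-- `vecMulLeft r` at `Y`. [cite: BurgisserClausenShokrollahi1997, §14.4] -/
@[simp] theorem vecMulLeft_apply (r : Fin 2 → ℂ) (Y : Matrix (Fin 2) (Fin 2) ℂ) :
    vecMulLeft r Y = Matrix.vecMul r Y := rfl

/-- `V ↦ V e` is onto for `e ≠ 0`. [cite: BurgisserClausenShokrollahi1997, §14.4] -/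
theorem mulVecRight_surjective {e : Fin 2 → ℂ} (he : e ≠ 0) :
    Function.Surjective (mulVecRight e) := by
  intro y
  rcases coord_ne_zero he with h0 | h1
  · refine ⟨Matrix.vecMulVec y ![(e 0)⁻¹, 0], ?_⟩
    funext i
    simp only [mulVecRight_apply, Matrix.mulVec, dotProduct, Fin.sum_univ_two,
      Matrix.vecMulVec_apply, Matrix.cons_val_zero, Matrix.cons_val_one]
    field_simp
    ring
  · refine ⟨Matrix.vecMulVec y ![0, (e 1)⁻¹], ?_⟩
    funext i
    simp only [mulVecRight_apply, Matrix.mulVec, dotProduct, Fin.sum_univ_two,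
      Matrix.vecMulVec_apply, Matrix.cons_val_zero, Matrix.cons_val_one]
    field_simp
    ring

/-- `Y ↦ r Y` is onto for `r ≠ 0`. [cite: BurgisserClausenShokrollahi1997, §14.4] -/
theorem vecMulLeft_surjective {r : Fin 2 → ℂ} (hr : r ≠ 0) :
    Function.Surjective (vecMulLeft r) := by
  intro y
  rcases coord_ne_zero hr with h0 | h1
  · refine ⟨Matrix.vecMulVec ![(r 0)⁻¹, 0] y, ?_⟩
    funext j
    simp only [vecMulLeft_apply, Matrix.vecMul, dotProduct, Fin.sum_univ_two,
      Matrix.vecMulVec_apply, Matrix.cons_val_zero, Matrix.cons_val_one]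
    field_simp
    ring
  · refine ⟨Matrix.vecMulVec ![0, (r 1)⁻¹] y, ?_⟩
    funext j
    simp only [vecMulLeft_apply, Matrix.vecMul, dotProduct, Fin.sum_univ_two,
      Matrix.vecMulVec_apply, Matrix.cons_val_zero, Matrix.cons_val_one]
    field_simp
    ring

/-- The kernel of a linear surjection `M₂(ℂ) → ℂ²` is `2`-dimensional, so every subspace inside it
has dimension `≤ 2`. [cite: BurgisserClausenShokrollahi1997, §14.4] -/
theorem finrank_le_two_of_le_ker (ρ : Matrix (Fin 2) (Fin 2) ℂ →ₗ[ℂ] (Fin 2 → ℂ))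
    (hρ : Function.Surjective ρ) {S : Submodule ℂ (Matrix (Fin 2) (Fin 2) ℂ)}
    (hS : S ≤ LinearMap.ker ρ) : Module.finrank ℂ S ≤ 2 := by
  have h1 := LinearMap.finrank_range_add_finrank_ker ρ
  have h2 : Module.finrank ℂ (LinearMap.range ρ) = 2 := by
    rw [LinearMap.range_eq_top.2 hρ, finrank_top, Module.finrank_fintype_fun_eq_card,
      Fintype.card_fin]
  have h3 : Module.finrank ℂ (Matrix (Fin 2) (Fin 2) ℂ) = 4 := by
    rw [Module.finrank_matrix, Module.finrank_self, Fintype.card_fin]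
  have h4 := Submodule.finrank_mono hS
  omega

section Core

variable {U : Type} [AddCommGroup U] [Module ℂ U]

/-- `dim range ≤ 4` for a linear map into `M₂(ℂ)`. [cite: BurgisserClausenShokrollahi1997, §14.4] -/
theorem finrank_range_le_four (p : U →ₗ[ℂ] Matrix (Fin 2) (Fin 2) ℂ) :
    Module.finrank ℂ (LinearMap.range p) ≤ 4 := by
  have h3 : Module.finrank ℂ (Matrix (Fin 2) (Fin 2) ℂ) = 4 := by
    rw [Module.finrank_matrix, Module.finrank_self, Fintype.card_fin]
  have := Submodule.finrank_le (LinearMap.range p)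
  omega

/-- Polarisation of `p(u)q(u) = 0`. [cite: BurgisserClausenShokrollahi1997, §17.1] -/
theorem polar (p q : U →ₗ[ℂ] Matrix (Fin 2) (Fin 2) ℂ) (hpq : ∀ u, p u * q u = 0) (u u' : U) :
    p u * q u' + p u' * q u = 0 := by
  have h := hpq (u + u')
  rw [map_add, map_add, add_mul, mul_add, mul_add, hpq u, hpq u', zero_add, add_zero] at h
  exact h

/-- Columns of a product: `(VY)·j = V(Y·j)`. [cite: BurgisserClausenShokrollahi1997, §14.4] -/
theorem mul_apply_eq_mulVec_col (V Y : Matrix (Fin 2) (Fin 2) ℂ) (i j : Fin 2) :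
    (V * Y) i j = V.mulVec (fun k => Y k j) i := by
  simp only [Matrix.mul_apply, Matrix.mulVec, dotProduct]

/-- **Core lemma.**  `p(u)·q(u) = 0` for all `u` ⟹ `dim range p + dim range q ≤ 4`.
[cite: BurgisserClausenShokrollahi1997, §17.1] -/
theorem finrank_range_add_le_four [FiniteDimensional ℂ U]
    (p q : U →ₗ[ℂ] Matrix (Fin 2) (Fin 2) ℂ) (hpq : ∀ u, p u * q u = 0) :
    Module.finrank ℂ (LinearMap.range p) + Module.finrank ℂ (LinearMap.range q) ≤ 4 := by
  classical
  have pol := polar p q hpq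
  -- (A) an invertible value of `p` kills `q`
  by_cases hA : ∀ u, (p u).det = 0
  swap
  · obtain ⟨u₀, hu₀⟩ := not_forall.1 hA
    have hunit : IsUnit (p u₀).det := isUnit_iff_ne_zero.2 hu₀
    have hkill : ∀ Y : Matrix (Fin 2) (Fin 2) ℂ, p u₀ * Y = 0 → Y = 0 := by
      intro Y hY
      have := congrArg (fun Z => (p u₀)⁻¹ * Z) hY
      simpa only [← Matrix.mul_assoc, Matrix.nonsing_inv_mul _ hunit, Matrix.one_mul,
        Matrix.mul_zero] using this
    have hq0 : q u₀ = 0 := hkill _ (hpq u₀)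
    have hq : q = 0 := by
      ext u : 1
      have h := pol u₀ u
      rw [hq0, Matrix.mul_zero, add_zero] at h
      rw [LinearMap.zero_apply]
      exact hkill _ h
    rw [LinearMap.range_eq_bot.2 hq, finrank_bot]
    have := finrank_range_le_four p
    omega
  -- (B) all values of `p` singular
  by_cases hp : p = 0
  · rw [LinearMap.range_eq_bot.2 hp, finrank_bot]
    have := finrank_range_le_four q
    omega
  obtain ⟨u₀, hu₀⟩ : ∃ u₀, p u₀ ≠ 0 := by
    by_contra h
    exact hp (LinearMap.ext fun u => not_ne_iff.1 (not_exists.1 h u))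
  obtain ⟨e₀, he₀, hV₀e₀⟩ := Matrix.exists_mulVec_eq_zero_iff.2 (hA u₀)
  -- columns killed by `V₀ = p u₀` are multiples of `e₀`
  have hcolV₀ : ∀ x, (p u₀).mulVec x = 0 → ∃ t : ℂ, x = t • e₀ :=
    fun x hx => exists_smul_of_mulVec_eq_zero hu₀ he₀ hV₀e₀ hx
  by_cases hB1 : ∀ u, (p u).mulVec e₀ = 0
  · -- (B1) common kernel vector `e₀`
    have hP : LinearMap.range p ≤ LinearMap.ker (mulVecRight e₀) := by
      rintro V ⟨u, rfl⟩
      rw [LinearMap.mem_ker, mulVecRight_apply]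
      exact hB1 u
    have h1 := finrank_le_two_of_le_ker _ (mulVecRight_surjective he₀) hP
    -- every column of every `q u` is a multiple of `e₀`, so `V₀ * q u = 0`
    have hVq : ∀ u, p u₀ * q u = 0 := by
      intro u
      by_cases hu : p u = 0
      · have h := pol u₀ u
        rwa [hu, Matrix.zero_mul, add_zero] at h
      · ext i j
        have hcol : (p u).mulVec (fun k => q u k j) = 0 := by
          funext i'
          rw [← mul_apply_eq_mulVec_col, hpq u]
          rfl
        obtain ⟨t, ht⟩ := exists_smul_of_mulVec_eq_zero hu he₀ (hB1 u) hcol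
        rw [mul_apply_eq_mulVec_col, ht, Matrix.mulVec_smul, hV₀e₀, smul_zero]
        rfl
    -- pick a non-zero row `r` of `V₀`; then `r * q u = 0`
    obtain ⟨k, hk⟩ : ∃ k, p u₀ k ≠ 0 := Function.ne_iff.1 hu₀
    have hQ : LinearMap.range q ≤ LinearMap.ker (vecMulLeft (p u₀ k)) := by
      rintro Y ⟨u, rfl⟩
      rw [LinearMap.mem_ker, vecMulLeft_apply]
      funext j
      have := congrFun (congrFun (hVq u) k) j
      rw [Matrix.mul_apply, Matrix.zero_apply] at this
      rw [Pi.zero_apply, ← this]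
      rfl
    have h2 := finrank_le_two_of_le_ker _ (vecMulLeft_surjective hk) hQ
    omega
  · -- (B2) some `p u₁` moves `e₀`: `a = p u₁ e₀ ≠ 0`
    obtain ⟨u₁, hu₁⟩ := not_forall.1 hB1
    set a : Fin 2 → ℂ := (p u₁).mulVec e₀ with ha
    have hpu₁ : p u₁ ≠ 0 := by
      intro h; apply hu₁; rw [ha, h, Matrix.zero_mulVec]
    obtain ⟨e₁, he₁, hV₁e₁⟩ := Matrix.exists_mulVec_eq_zero_iff.2 (hA u₁)
    -- `e₀, e₁` is a basis
    have hbasis : cr e₀ e₁ ≠ 0 := by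
      intro h
      obtain ⟨t, ht⟩ := exists_smul_of_cr_eq_zero he₀ h
      apply hu₁
      have h1 : (p u₁).mulVec e₁ = t • a := by rw [ht, Matrix.mulVec_smul]
      rw [hV₁e₁] at h1
      rcases eq_or_ne t 0 with rfl | ht0
      · rw [zero_smul] at ht; exact absurd ht he₁
      · exact (smul_eq_zero.1 h1.symm).resolve_left ht0
    -- singularity along lines: the coefficient of `t`
    have hsing : ∀ u, ∀ x y, cr ((p u).mulVec x) ((p u).mulVec y) = 0 := by
      intro u x y; rw [cr_mulVec, hA u, zero_mul]
    -- Step 1: `p u e₁ ∥ a`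
    have step1 : ∀ u, cr a ((p u).mulVec e₁) = 0 := by
      intro u
      have h0 := hsing u e₀ e₁
      have h1 := hsing (u + u₁) e₀ e₁
      rw [map_add, Matrix.add_mulVec, Matrix.add_mulVec, hV₁e₁, add_zero, ← ha, cr_swap,
        cr_add_right, cr_swap ((p u).mulVec e₁) ((p u).mulVec e₀), h0] at h1
      rw [cr_swap]
      linear_combination h1
    -- `a' = V₀ e₁` is a non-zero multiple of `a`
    have ha'ne : (p u₀).mulVec e₁ ≠ 0 := by
      intro h
      exact hu₀ (eq_zero_of_mulVec_pair hV₀e₀ h hbasis)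
    have ha0 : a ≠ 0 := hu₁
    obtain ⟨s, hs⟩ := exists_smul_of_cr_eq_zero ha0 (step1 u₀)
    have hs0 : s ≠ 0 := by
      rintro rfl; rw [zero_smul] at hs; exact ha'ne hs
    -- Step 2: `p u e₀ ∥ a`
    have step2 : ∀ u, cr a ((p u).mulVec e₀) = 0 := by
      intro u
      have h0 := hsing u e₀ e₁
      have h1 := hsing (u + u₀) e₀ e₁
      rw [map_add, Matrix.add_mulVec, Matrix.add_mulVec, hV₀e₀, add_zero, cr_add_right, h0,
        zero_add, hs, cr_smul_right] at h1
      have h2 : cr ((p u).mulVec e₀) a = 0 := (mul_eq_zero.1 h1).resolve_left hs0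
      rw [cr_swap, h2, neg_zero]
    -- hence every column of `p u` is parallel to `a`: `g * p u = 0` with `g = (−a₁, a₀)`
    have hcol : ∀ u x, cr a ((p u).mulVec x) = 0 := by
      intro u x
      rw [cramer_two hbasis x, Matrix.mulVec_add, Matrix.mulVec_smul, Matrix.mulVec_smul,
        cr_add_right, cr_smul_right, cr_smul_right, step1 u, step2 u, mul_zero, mul_zero,
        add_zero]
    have hg : (![-(a 1), a 0] : Fin 2 → ℂ) ≠ 0 := by
      intro h
      apply ha0
      have h0 := congrFun h 0
      have h1 := congrFun h 1
      simp only [Matrix.cons_val_zero, Matrix.cons_val_one, Pi.zero_apply,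
        neg_eq_zero] at h0 h1
      funext i; fin_cases i
      · simpa using h1
      · simpa using h0
    have hP : LinearMap.range p ≤ LinearMap.ker (vecMulLeft ![-(a 1), a 0]) := by
      rintro V ⟨u, rfl⟩
      rw [LinearMap.mem_ker, vecMulLeft_apply]
      funext j
      have h := hcol u (Pi.single j 1)
      simp only [cr, Matrix.mulVec, dotProduct, Fin.sum_univ_two, Pi.single_apply] at h
      simp only [Matrix.vecMul, dotProduct, Fin.sum_univ_two, Matrix.cons_val_zero,
        Matrix.cons_val_one, Pi.zero_apply]
      fin_cases j
      · simp at h ⊢; linear_combination h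
      · simp at h ⊢; linear_combination h
    have h1 := finrank_le_two_of_le_ker _ (vecMulLeft_surjective hg) hP
    -- `ker p ≤ ker q`
    have hker : LinearMap.ker p ≤ LinearMap.ker q := by
      intro u hu
      rw [LinearMap.mem_ker] at hu ⊢
      have hq0 : p u₀ * q u = 0 := by
        have h := pol u₀ u; rwa [hu, Matrix.zero_mul, add_zero] at h
      have hq1 : p u₁ * q u = 0 := by
        have h := pol u₁ u; rwa [hu, Matrix.zero_mul, add_zero] at h
      ext i j
      have c0 : (p u₀).mulVec (fun k => q u k j) = 0 := by
        funext i'; rw [← mul_apply_eq_mulVec_col, hq0]; rfl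
      have c1 : (p u₁).mulVec (fun k => q u k j) = 0 := by
        funext i'; rw [← mul_apply_eq_mulVec_col, hq1]; rfl
      obtain ⟨t, ht⟩ := hcolV₀ _ c0
      rw [ht, Matrix.mulVec_smul, ← ha] at c1
      have ht0 : t = 0 := (smul_eq_zero.1 c1).resolve_right ha0
      have := congrFun ht i
      rw [ht0, zero_smul] at this
      simpa using this
    have hq := LinearMap.finrank_range_add_finrank_ker q
    have hp' := LinearMap.finrank_range_add_finrank_ker p
    have hmono := Submodule.finrank_mono hker
    omega

end Core

end Summit.MatrixMultiplication.MatrixMultiplication.Theorems.OutsiderSandwichCoreTwoByTwo
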